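import Mathlib
import Summits.Ventures.HodgeRepro2.T5EpsilonTwist

/-!
# T5LocalRingGaussSum — Gauss sums over a finite LOCAL ring: `G(χ,ψ)·G(χ⁻¹,ψ⁻¹) = |R|` for a primitive `χ`

Kernel support for Tier 5, sub-step N5 / §G, reading residual [R-4] («Tate half»; route/T5-CHECK-G-p7.md §4,
§12.2 row P1.7, §16). The derivation of the ε-factor identity (T1) in `T5EpsilonTwist` takes the Gauss-sum
identity `𝔤(ω|_U)·𝔤(ω⁻¹|_U) = ω(−1)` as a HYPOTHESIS (`hG` of `epsShape_mul_epsShape_inv`); `T5TameGaussSum`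
discharges it at conductor exponent `1`, where the sum lives on the residue FIELD and Mathlib's
`gaussSum_mul_gaussSum_eq_card` applies. This file discharges it for a character of ANY conductor exponent
`n ≥ 1`: the sum then lives on the finite LOCAL ring `R = 𝒪_v / 𝔭_v^n` (maximal ideal `𝔪 = 𝔭_v/𝔭_v^n`), the
additive character `x ↦ ψ_v(x ϖ^{-n})` is primitive on `R` exactly when `ψ_v` has conductor `𝒪_v`, and
«conductor exactly `n`» means that `ω` is non-trivial on `1 + 𝔭^{n-1}/𝔭^n = 1 + Ann(𝔪)`.

For a finite commutative local ring `R` and a domain `R'` of values we prove: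

* `gaussSum_mul_gaussSum_inv_eq_card`: `gaussSum χ ψ * gaussSum χ⁻¹ ψ⁻¹ = Fintype.card R` whenever `ψ` is
  primitive (`AddChar.IsPrimitive`) and `χ` is primitive in the sense `IsPrimitiveChar`: non-trivial at some
  unit `t` with `(t − 1)·𝔪 = 0`, i.e. on the subgroup `1 + Ann(𝔪)` (for a field the side condition is void and
  `IsPrimitiveChar χ ↔ χ ≠ 1`, `isPrimitiveChar_iff_ne_one`, so the statement specialises to Mathlib's);
* the consequences `gaussSum_mul_gaussSum_inv` (`= χ(−1)·|R|`), `gaussSum_ne_zero`, the normalised identity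
  `gNorm_mul_gNorm_inv` (`gNorm χ ψ * gNorm χ⁻¹ ψ = χ (−1)` with `gNorm = |R|^{-1/2}·gaussSum`, Kudla's `𝔤`),
  and the hook `epsShape_mul_epsShape_inv_of_primitive` into `T5EpsilonTwist.epsShape_mul_epsShape_inv`
  (identity (T1) of CHECK-G §4 with the Gauss-sum hypothesis DISCHARGED).

The proof is the textbook one. `G(χ,ψ)·G(χ⁻¹,ψ⁻¹) = Σ_t χ(t)·Σ_{u ∈ R^×} ψ(u(t−1))`; the inner sum over the
units is the full sum (`|R|·[t = 1]` by primitivity of `ψ`, `AddChar.sum_mulShift`) minus the sum over the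
non-units `𝔪`, which is `|𝔪|` if `(t−1)·𝔪 = 0` and `0` otherwise (`sum_nonunits_mulShift_eq_zero`: a non-zero
ideal is never inside `ker ψ` when `ψ` is primitive, so `ψ(·(t−1))` is a non-trivial character of the additive
group `𝔪`); the remaining sum `Σ_{t ∈ 1+Ann 𝔪} χ(t)` vanishes because `χ` is non-trivial on that subgroup
(`sum_mulChar_eq_zero_of_mulLeft_mem_iff`). Nothing about local fields, conductors or ε-factors is defined here.
-/

namespace Summit.Ventures.HodgeRepro2.T5LocalRingGaussSum

open Finset

/-! ### Translation-invariant sums of characters vanish -/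

section Translation

variable {R' : Type*} [CommRing R'] [IsDomain R']

/-- If a finset `s` of an additive group is invariant under translation by `x` and the additive
character `ψ` is non-trivial at `x`, then `ψ` sums to `0` over `s`. -/
theorem sum_eq_zero_of_addLeft_mem_iff {A : Type*} [AddCommGroup A] (s : Finset A)
    (ψ : AddChar A R') {x : A} (hs : ∀ i, i ∈ s ↔ x + i ∈ s) (hψ : ψ x ≠ 1) :
    ∑ y ∈ s, ψ y = 0 := by
  have h : ∑ y ∈ s, ψ (x + y) = ∑ y ∈ s, ψ y :=
    Finset.sum_equiv (Equiv.addLeft x) (fun i => hs i) (fun i _ => rfl)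
  simp_rw [AddChar.map_add_eq_mul] at h
  rw [← Finset.mul_sum] at h
  exact eq_zero_of_mul_eq_self_left hψ h

/-- If a finset `s` of a commutative ring is invariant under multiplication by a unit `t₀` and the
multiplicative character `χ` is non-trivial at `t₀`, then `χ` sums to `0` over `s`. -/
theorem sum_mulChar_eq_zero_of_mulLeft_mem_iff {R : Type*} [CommRing R] (s : Finset R)
    (χ : MulChar R R') (t₀ : Rˣ) (hs : ∀ i, i ∈ s ↔ (t₀ : R) * i ∈ s) (hχ : χ t₀ ≠ 1) :
    ∑ t ∈ s, χ t = 0 := by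
  have h : ∑ t ∈ s, χ ((t₀ : R) * t) = ∑ t ∈ s, χ t :=
    Finset.sum_equiv (Units.mulLeft t₀) (fun i => hs i) (fun i _ => rfl)
  simp_rw [map_mul] at h
  rw [← Finset.mul_sum] at h
  exact eq_zero_of_mul_eq_self_left hχ h

end Translation

/-! ### Primitive multiplicative characters of a local ring -/

section Defs

variable {R : Type*} [CommRing R]

/-- `KillsNonunits c`: `y * c = 0` for every non-unit `y`. In a local ring this says that `c`
annihilates the maximal ideal `𝔪` (`killsNonunits_iff_mem_annihilator`); for `R = 𝒪/𝔭^n` it means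
`c ∈ 𝔭^{n-1}/𝔭^n`. -/
def KillsNonunits (c : R) : Prop := ∀ y : R, ¬ IsUnit y → y * c = 0

/-- A multiplicative character `χ` of a commutative ring is *primitive* (in the sense relevant to a
finite local ring) if it is non-trivial at some unit `t` with `t − 1` annihilating the non-units,
i.e. non-trivial on the subgroup `1 + Ann(𝔪)` of the units. For `R = 𝒪/𝔭^n` this is «the conductor of
`χ` is exactly `𝔭^n`» (non-triviality on `1 + 𝔭^{n-1}`); for a field the side condition is void and
`IsPrimitiveChar χ ↔ χ ≠ 1` (`isPrimitiveChar_iff_ne_one`). -/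
def IsPrimitiveChar {R' : Type*} [CommMonoidWithZero R'] (χ : MulChar R R') : Prop :=
  ∃ t : Rˣ, KillsNonunits ((t : R) - 1) ∧ χ t ≠ 1

/-- Membership in `1 + Ann(𝔪)` is invariant under multiplication by an element of `1 + Ann(𝔪)`:
the translation-invariance used for the final sum. -/
theorem killsNonunits_mul_sub_one_iff {t₀ : Rˣ} (h : KillsNonunits ((t₀ : R) - 1)) (i : R) :
    KillsNonunits (i - 1) ↔ KillsNonunits ((t₀ : R) * i - 1) := by
  constructor
  · intro hi y hy
    have h1 := hi y hy
    have h2 := h y hy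
    linear_combination (t₀ : R) * h1 + h2
  · intro hi y hy
    have h1 := hi y hy
    have h2 := h y hy
    have h3 : ((t₀⁻¹ : Rˣ) : R) * t₀ = 1 := Units.inv_mul t₀
    linear_combination ((t₀⁻¹ : Rˣ) : R) * h1 - ((t₀⁻¹ : Rˣ) : R) * h2 - (y * (i - 1)) * h3

/-- `¬ IsUnit a ↔ a ∈ 𝔪` in a local ring. -/
theorem not_isUnit_iff_mem_maximalIdeal [IsLocalRing R] (a : R) :
    ¬ IsUnit a ↔ a ∈ IsLocalRing.maximalIdeal R :=
  ((IsLocalRing.mem_maximalIdeal a).trans mem_nonunits_iff).symm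

/-- In a local ring, `KillsNonunits c` is membership of `c` in the annihilator of the maximal ideal. -/
theorem killsNonunits_iff_mem_annihilator [IsLocalRing R] (c : R) :
    KillsNonunits c ↔ c ∈ (IsLocalRing.maximalIdeal R).annihilator := by
  rw [Submodule.mem_annihilator]
  constructor
  · intro hc y hy
    rw [smul_eq_mul, mul_comm]
    exact hc y (mem_nonunits_iff.1 ((IsLocalRing.mem_maximalIdeal y).1 hy))
  · intro hc y hy
    rw [mul_comm, ← smul_eq_mul]
    exact hc y ((IsLocalRing.mem_maximalIdeal y).2 (mem_nonunits_iff.2 hy))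

/-- In a field every element kills the (zero) non-units, so primitivity is plain non-triviality. -/
theorem isPrimitiveChar_iff_ne_one {k : Type*} [Field k] {R' : Type*} [CommMonoidWithZero R']
    {χ : MulChar k R'} : IsPrimitiveChar χ ↔ χ ≠ 1 := by
  rw [MulChar.ne_one_iff]
  constructor
  · rintro ⟨t, -, ht⟩
    exact ⟨t, ht⟩
  · rintro ⟨t, ht⟩
    refine ⟨t, fun y hy => ?_, ht⟩
    rw [isUnit_iff_ne_zero, not_not] at hy
    rw [hy, zero_mul]

end Defs

/-! ### The sum over the non-units -/

section LocalRing

variable {R : Type*} [CommRing R] [Fintype R] {R' : Type*} [CommRing R']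
  [DecidablePred (IsUnit : R → Prop)]

/-- If `c` kills the non-units, `ψ(y·c) = 1` on the non-units and the sum is their number. -/
theorem sum_nonunits_mulShift_eq_card (ψ : AddChar R R') {c : R} (hc : KillsNonunits c) :
    ∑ y ∈ univ.filter (fun y : R => ¬ IsUnit y), ψ (y * c)
      = ((univ.filter (fun y : R => ¬ IsUnit y)).card : R') := by
  rw [Finset.card_eq_sum_ones, Nat.cast_sum]
  refine Finset.sum_congr rfl (fun y hy => ?_)
  rw [hc y (Finset.mem_filter.1 hy).2, AddChar.map_zero_eq_one, Nat.cast_one]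

/-- If `c` does NOT kill the non-units and `ψ` is primitive, then `y ↦ ψ(y·c)` is a non-trivial
character of the additive group `𝔪` of non-units, so it sums to `0` over `𝔪`. -/
theorem sum_nonunits_mulShift_eq_zero [IsLocalRing R] [IsDomain R'] {ψ : AddChar R R'}
    (hψ : ψ.IsPrimitive) {c : R} (hc : ¬ KillsNonunits c) :
    ∑ y ∈ univ.filter (fun y : R => ¬ IsUnit y), ψ (y * c) = 0 := by
  simp only [KillsNonunits, not_forall] at hc
  obtain ⟨y₀, hy₀, hne⟩ := hc
  -- primitivity of `ψ`: the shift by the non-zero element `y₀ * c` is non-trivial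
  obtain ⟨z, hz⟩ := AddChar.ne_one_iff.1 (hψ hne)
  rw [AddChar.mulShift_apply] at hz
  -- the non-unit `x := z * y₀` has `ψ (x * c) ≠ 1`
  have hx : ¬ IsUnit (z * y₀) := by
    rw [not_isUnit_iff_mem_maximalIdeal]
    exact Ideal.mul_mem_left _ z ((not_isUnit_iff_mem_maximalIdeal y₀).1 hy₀)
  have hxc : (ψ.mulShift c) (z * y₀) ≠ 1 := by
    rw [AddChar.mulShift_apply]
    rwa [show c * (z * y₀) = y₀ * c * z by ring]
  have key : ∑ y ∈ univ.filter (fun y : R => ¬ IsUnit y), (ψ.mulShift c) y = 0 := by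
    refine sum_eq_zero_of_addLeft_mem_iff _ _ (fun i => ?_) hxc
    simp only [Finset.mem_filter, Finset.mem_univ, true_and]
    rw [not_isUnit_iff_mem_maximalIdeal, not_isUnit_iff_mem_maximalIdeal]
    exact (Submodule.add_mem_iff_right _ ((not_isUnit_iff_mem_maximalIdeal _).1 hx)).symm
  simpa only [AddChar.mulShift_apply, mul_comm] using key

end LocalRing

/-! ### The product formula -/

section Main

variable {R : Type*} [CommRing R] [Fintype R] [IsLocalRing R]
  {R' : Type*} [CommRing R'] [IsDomain R']

/-- **Gauss sums over a finite local ring.** For a primitive multiplicative character `χ`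
(`IsPrimitiveChar`) and a primitive additive character `ψ` of a finite commutative local ring `R`,
`gaussSum χ ψ * gaussSum χ⁻¹ ψ⁻¹ = Fintype.card R`. For a field this is Mathlib's
`gaussSum_mul_gaussSum_eq_card`; for `R = 𝒪_v/𝔭_v^n` it is the higher-conductor case of the Gauss-sum
identity behind (T1) of CHECK-G §4. -/
theorem gaussSum_mul_gaussSum_inv_eq_card {χ : MulChar R R'} (hχ : IsPrimitiveChar χ)
    {ψ : AddChar R R'} (hψ : ψ.IsPrimitive) :
    gaussSum χ ψ * gaussSum χ⁻¹ ψ⁻¹ = Fintype.card R := by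
  classical
  obtain ⟨t₀, ht₀, hχt₀⟩ := hχ
  -- Step 1: expand the product as a double sum.
  have h1 : gaussSum χ ψ * gaussSum χ⁻¹ ψ⁻¹ = ∑ y, ∑ x, χ x * χ⁻¹ y * ψ (x - y) := by
    simp only [gaussSum, Finset.sum_mul_sum, AddChar.inv_apply]
    rw [Finset.sum_comm]
    refine Finset.sum_congr rfl fun y _ => Finset.sum_congr rfl fun x _ => ?_
    rw [sub_eq_add_neg, AddChar.map_add_eq_mul]
    ring
  -- Step 2: for a unit `y`, substitute `x = t * y`; for a non-unit `y`, `χ⁻¹ y = 0`.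
  have h2 : ∀ y : R, ∑ x, χ x * χ⁻¹ y * ψ (x - y)
      = if IsUnit y then ∑ t, χ t * ψ (y * (t - 1)) else 0 := by
    intro y
    split_ifs with hy
    · obtain ⟨u, rfl⟩ := hy
      have hu : χ⁻¹ u * χ u = 1 := by
        rw [← MulChar.mul_apply, MulChar.inv_mul, MulChar.one_apply_coe]
      refine (Fintype.sum_bijective (· * (u : R)) (Units.mulRight_bijective u) _ _
        (fun t => ?_)).symm
      rw [map_mul χ, show t * (u : R) - u = u * (t - 1) by ring]
      rw [mul_assoc (χ t), mul_comm (χ u), hu, mul_one]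
    · simp only [MulChar.map_nonunit χ⁻¹ hy, mul_zero, zero_mul, Finset.sum_const_zero]
  -- Step 3: the sum over the units of `ψ(y·c)`, via the sum over all of `R` and over `𝔪`.
  have h4 : ∀ c : R, ∑ y ∈ univ.filter (fun y : R => IsUnit y), ψ (y * c)
      = ((if c = 0 then Fintype.card R else 0 : ℕ) : R')
        - ∑ y ∈ univ.filter (fun y : R => ¬ IsUnit y), ψ (y * c) := by
    intro c
    rw [← AddChar.sum_mulShift c hψ,
      ← Finset.sum_filter_add_sum_filter_not univ (fun y : R => IsUnit y)]
    ring
  have h5 : ∀ c : R, ∑ y ∈ univ.filter (fun y : R => ¬ IsUnit y), ψ (y * c)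
      = if KillsNonunits c then ((univ.filter (fun y : R => ¬ IsUnit y)).card : R') else 0 := by
    intro c
    split_ifs with hc
    · exact sum_nonunits_mulShift_eq_card ψ hc
    · exact sum_nonunits_mulShift_eq_zero hψ hc
  -- Step 4: assemble.
  rw [h1]
  simp_rw [h2]
  rw [← Finset.sum_filter, Finset.sum_comm]
  simp_rw [← Finset.mul_sum, h4, h5, Nat.cast_ite, Nat.cast_zero, mul_sub, Finset.sum_sub_distrib,
    mul_ite, mul_zero, sub_eq_zero]
  rw [Finset.sum_ite_eq' univ (1 : R)]
  simp only [Finset.mem_univ, if_true, MulChar.map_one, one_mul]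
  rw [← Finset.sum_filter, ← Finset.sum_mul,
    sum_mulChar_eq_zero_of_mulLeft_mem_iff _ χ t₀ (fun i => ?_) hχt₀, zero_mul, sub_zero]
  simp only [Finset.mem_filter, Finset.mem_univ, true_and]
  exact killsNonunits_mul_sub_one_iff ht₀ i

/-- `χ(−1)·G(χ, ψ⁻¹) = G(χ, ψ)` for any finite commutative ring (Mathlib states
`mul_gaussSum_inv_eq_gaussSum` for a field only; the proof does not use it). -/
theorem mul_gaussSum_inv_eq_gaussSum_of_commRing {S : Type*} [CommRing S] [Fintype S]
    {S' : Type*} [CommRing S'] (χ : MulChar S S') (ψ : AddChar S S') :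
    χ (-1) * gaussSum χ ψ⁻¹ = gaussSum χ ψ := by
  rw [ψ.inv_mulShift, ← Units.coe_neg_one]
  exact gaussSum_mulShift χ ψ (-1)

/-- `χ⁻¹(−1) = χ(−1)`: the value at `−1` is its own inverse. -/
theorem inv_apply_neg_one {S : Type*} [CommRing S] {S' : Type*} [CommMonoidWithZero S']
    (χ : MulChar S S') : χ⁻¹ (-1) = χ (-1) := by
  rw [MulChar.inv_apply, ← Units.coe_neg_one, Ring.inverse_unit, inv_neg_one, Units.coe_neg_one]

/-- `G(χ,ψ)·G(χ⁻¹,ψ) = χ(−1)·|R|` — the identity in the form used by (T1) of CHECK-G §4. -/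
theorem gaussSum_mul_gaussSum_inv {χ : MulChar R R'} (hχ : IsPrimitiveChar χ)
    {ψ : AddChar R R'} (hψ : ψ.IsPrimitive) :
    gaussSum χ ψ * gaussSum χ⁻¹ ψ = χ (-1) * Fintype.card R := by
  rw [← mul_gaussSum_inv_eq_gaussSum_of_commRing χ⁻¹ ψ, inv_apply_neg_one, mul_left_comm,
    gaussSum_mul_gaussSum_inv_eq_card hχ hψ]

/-- The Gauss sum of a primitive character of a finite local ring does not vanish (when `|R| ≠ 0`
in the value ring). -/
theorem gaussSum_ne_zero (h : (Fintype.card R : R') ≠ 0) {χ : MulChar R R'}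
    (hχ : IsPrimitiveChar χ) {ψ : AddChar R R'} (hψ : ψ.IsPrimitive) : gaussSum χ ψ ≠ 0 := by
  intro H
  apply h
  rw [← gaussSum_mul_gaussSum_inv_eq_card hχ hψ, H, zero_mul]

/-- Consistency with the field case: for a field, `IsPrimitiveChar χ ↔ χ ≠ 1` and the product
formula is Mathlib's `gaussSum_mul_gaussSum_eq_card`. -/
theorem gaussSum_mul_gaussSum_inv_eq_card_of_field {k : Type*} [Field k] [Fintype k]
    {χ : MulChar k R'} (hχ : χ ≠ 1) {ψ : AddChar k R'} (hψ : ψ.IsPrimitive) :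
    gaussSum χ ψ * gaussSum χ⁻¹ ψ⁻¹ = Fintype.card k :=
  gaussSum_mul_gaussSum_inv_eq_card (isPrimitiveChar_iff_ne_one.2 hχ) hψ

end Main

/-! ### Kudla's normalisation and the hook into (T1) -/

section Normalised

variable {R : Type*} [CommRing R] [Fintype R] [IsLocalRing R]

/-- `|R|^{-1/2}·G(χ,ψ)` — Kudla's normalised Gauss sum `𝔤` for a finite commutative ring
(`T5TameGaussSum.gNorm` is the same expression for a field). -/
noncomputable def gNorm (χ : MulChar R ℂ) (ψ : AddChar R ℂ) : ℂ :=
  ((Real.sqrt (Fintype.card R) : ℝ) : ℂ)⁻¹ * gaussSum χ ψ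

/-- `𝔤(χ)·𝔤(χ⁻¹) = χ(−1)` for a primitive character of a finite local ring: the Gauss-sum identity
of (T1) (CHECK-G §4, «substitution `y ↦ −y` … `|𝔤| = 1`») at any conductor exponent. -/
theorem gNorm_mul_gNorm_inv {χ : MulChar R ℂ} (hχ : IsPrimitiveChar χ) {ψ : AddChar R ℂ}
    (hψ : ψ.IsPrimitive) : gNorm χ ψ * gNorm χ⁻¹ ψ = χ (-1) := by
  have hc : ((Real.sqrt (Fintype.card R) : ℝ) : ℂ) * ((Real.sqrt (Fintype.card R) : ℝ) : ℂ)
      = (Fintype.card R : ℂ) := by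
    rw [← Complex.ofReal_mul, Real.mul_self_sqrt (Nat.cast_nonneg _), Complex.ofReal_natCast]
  have hcard : (Fintype.card R : ℂ) ≠ 0 := Nat.cast_ne_zero.2 Fintype.card_ne_zero
  have h : gNorm χ ψ * gNorm χ⁻¹ ψ
      = (gaussSum χ ψ * gaussSum χ⁻¹ ψ) * (((Real.sqrt (Fintype.card R) : ℝ) : ℂ)
          * ((Real.sqrt (Fintype.card R) : ℝ) : ℂ))⁻¹ := by
    unfold gNorm
    rw [mul_inv]
    ring
  rw [h, gaussSum_mul_gaussSum_inv hχ hψ, hc, mul_assoc, mul_inv_cancel₀ hcard, mul_one]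

/-- The ε-factor identity (T1) of CHECK-G §4 with its Gauss-sum hypothesis DISCHARGED at any conductor
exponent: `T5EpsilonTwist.epsShape_mul_epsShape_inv` applied with `G(ω|_U) = 𝔤(χ)`, `G(ω⁻¹|_U) = 𝔤(χ⁻¹)`
and `ω(m1) = χ(−1)`, for a primitive `χ` of the finite local ring `R = 𝒪_v/𝔭_v^n`. The analogue of
`T5TameGaussSum.epsShape_mul_epsShape_inv_of_tame` (residue field, `n = 1`). -/
theorem epsShape_mul_epsShape_inv_of_primitive {Kx : Type*} [CommGroup Kx] (U : Subgroup Kx)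
    (ϖ : Kx) {q : ℂ} (hq : q ≠ 0) (n : ℤ) (c : (Kx →* ℂˣ) → ℕ) (G : (U →* ℂˣ) → ℂ) (s : ℂ)
    (ω : Kx →* ℂˣ) (m1 : Kx) (hc : c ω⁻¹ = c ω) {χ : MulChar R ℂ} (hχ : IsPrimitiveChar χ)
    {ψ : AddChar R ℂ} (hψ : ψ.IsPrimitive) (hG : G (ω.restrict U) = gNorm χ ψ)
    (hG' : G (ω⁻¹.restrict U) = gNorm χ⁻¹ ψ) (hm : ((ω m1 : ℂˣ) : ℂ) = χ (-1)) :
    T5EpsilonTwist.epsShape U ϖ q n c G s ω * T5EpsilonTwist.epsShape U ϖ q n c G (1 - s) ω⁻¹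
      = ((ω m1 : ℂˣ) : ℂ) :=
  T5EpsilonTwist.epsShape_mul_epsShape_inv U ϖ hq n c G s ω m1 hc
    (by rw [hG, hG', gNorm_mul_gNorm_inv hχ hψ, hm])

end Normalised

end Summit.Ventures.HodgeRepro2.T5LocalRingGaussSum
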